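import Mathlib.Analysis.Fourier.LpSpace
import Mathlib.Analysis.Calculus.LineDeriv.IntegrationByParts
import Mathlib.Analysis.Distribution.AEEqOfIntegralContDiff
import HarnessLib

/-!
# Route PerpetualPump · `EulerTypeIGlue` — toolkit II: derivatives under the `L²` Fourier
# transform (physical → Fourier transfer of Sobolev regularity)

Support file for the support item `EulerTypeIGlue` (stmt-NavierStokesRegularity-1838). The
dictionary between classical Navier–Stokes solutions and Tao's `H¹⁰_df`-mild solutions needs the
elementary fact that for a `C¹` function `f` with `f, ∂_m f ∈ L²` the Plancherel transform of
`∂_m f` is `2πi ⟨ξ, m⟩ f̂(ξ)` — for functions that are **not** integrable (finite-energy solutions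
are `H^k`, not `L¹`), so that the Fourier integral is unavailable. The proof goes through
Mathlib's tempered distributions: `T_{∂_m f} = ∂_m T_f` (integration by parts against Schwartz
functions, Mathlib `integral_smul_fderiv_eq_neg_fderiv_smul_of_integrable`), Mathlib's
`TemperedDistribution.fourier_lineDerivOp_eq`, the compatibility of the `L²` and `𝓢'` transforms
(`MeasureTheory.Lp.fourier_toTemperedDistribution_eq`), and the injectivity of `L^p → 𝓢'` after
multiplication by the bounded weight `(1+|ξ|²)⁻¹` (`MeasureTheory.Lp.toTemperedDistribution_smul_eq`).
Iterating along a fixed direction gives `𝓕[(∂_m)^k f] = (2πi⟨ξ,m⟩)^k 𝓕[f]` and the weighted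
Plancherel bound `∫ |2π⟨ξ,m⟩|^{2k} |f̂|² = ‖(∂_m)^k f‖²_{L²} ≤ ‖m‖^{2k} ‖D^k f‖²_{L²}`. Also: the
`L²` transform commutes with continuous linear maps of the range.

## References

* E. M. Stein, G. Weiss, *Introduction to Fourier Analysis on Euclidean Spaces* (1971), Ch. I
  §1 (Thm. 1.8: `(∂f)^ = 2πi ξ f̂`) and §3 (tempered distributions).
* T. Tao, J. Amer. Math. Soc. 29 (2016), arXiv:1402.0290v3, §1.1 p. 3 (`H¹⁰_df`: Sobolev
  regularity and divergence read on the Fourier side). [Tao2016AveragedNS]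
-/

noncomputable section

open MeasureTheory Set Filter Topology FourierTransform SchwartzMap TemperedDistribution
open scoped ENNReal NNReal FourierTransform RealInnerProductSpace ContDiff LineDeriv

set_option linter.dupNamespace false

namespace Summit.NavierStokesRegularity.NavierStokesRegularity.Theorems.PerpetualPumpEulerTypeIGlue

variable {V : Type*} [NormedAddCommGroup V] [InnerProductSpace ℝ V] [FiniteDimensional ℝ V]
  [MeasurableSpace V] [BorelSpace V]
variable {F : Type*} [NormedAddCommGroup F] [InnerProductSpace ℂ F] [CompleteSpace F]
variable {F' : Type*} [NormedAddCommGroup F'] [InnerProductSpace ℂ F'] [CompleteSpace F']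

/-! ### Integrability of Schwartz-weighted `L²` functions -/

omit [CompleteSpace F] in
/-- `g • h ∈ L¹` for a Schwartz scalar `g` and `h ∈ L²`. [folklore] -/
theorem integrable_schwartz_smul_of_memLp (g : 𝓢(V, ℂ)) {h : V → F} (hh : MemLp h 2 volume) :
    Integrable (fun x => g x • h x) volume := by
  have h2 : MemLp (⇑g) 2 (volume : Measure V) := g.memLp 2 volume
  have := MemLp.smul (p := 2) (q := 2) (r := 1) hh h2
  exact memLp_one_iff_integrable.1 this

/-! ### The `L²` Fourier transform commutes with continuous linear maps of the range -/

/-- **`𝓕 (L ∘ u) = L ∘ 𝓕 u` on `L²`** (a.e. form) for a continuous `ℂ`-linear `L : F → F'`: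
both sides induce the same tempered distribution. [folklore] -/
theorem fourier_compLp_ae_eq (L : F →L[ℂ] F') (u : Lp F 2 (volume : Measure V)) :
    ((𝓕 (L.compLp u) : Lp F' 2 (volume : Measure V)) : V → F') =ᵐ[volume]
      fun ξ => L (((𝓕 u : Lp F 2 (volume : Measure V)) : V → F) ξ) := by
  have key : ∀ g : 𝓢(V, ℂ),
      ∫ x, g x • ((𝓕 (L.compLp u) : Lp F' 2 (volume : Measure V)) : V → F') x =
        ∫ x, g x • L (((𝓕 u : Lp F 2 (volume : Measure V)) : V → F) x) := by
    intro g
    -- left-hand side through `𝓢'`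
    have h1 : ∫ x, g x • ((𝓕 (L.compLp u) : Lp F' 2 (volume : Measure V)) : V → F') x =
        ∫ x, (𝓕 g : 𝓢(V, ℂ)) x • ((L.compLp u : Lp F' 2 (volume : Measure V)) : V → F') x := by
      rw [← Lp.toTemperedDistribution_apply, ← Lp.fourier_toTemperedDistribution_eq,
        TemperedDistribution.fourier_apply, Lp.toTemperedDistribution_apply]
    have h2 : ∫ x, (𝓕 g : 𝓢(V, ℂ)) x • ((L.compLp u : Lp F' 2 (volume : Measure V)) : V → F') x =
        ∫ x, L ((𝓕 g : 𝓢(V, ℂ)) x • (u : V → F) x) := by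
      refine integral_congr_ae ?_
      filter_upwards [ContinuousLinearMap.coeFn_compLp L u] with x hx
      rw [hx, L.map_smul]
    have h3 : ∫ x, L ((𝓕 g : 𝓢(V, ℂ)) x • (u : V → F) x) = L (∫ x, (𝓕 g : 𝓢(V, ℂ)) x • (u : V → F) x) :=
      ContinuousLinearMap.integral_comp_comm L (integrable_schwartz_smul_of_memLp (𝓕 g) (Lp.memLp u))
    -- right-hand side through `𝓢'`
    have h4 : ∫ x, (𝓕 g : 𝓢(V, ℂ)) x • (u : V → F) x =
        ∫ x, g x • ((𝓕 u : Lp F 2 (volume : Measure V)) : V → F) x := by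
      rw [← Lp.toTemperedDistribution_apply, ← TemperedDistribution.fourier_apply,
        Lp.fourier_toTemperedDistribution_eq, Lp.toTemperedDistribution_apply]
    have h5 : L (∫ x, g x • ((𝓕 u : Lp F 2 (volume : Measure V)) : V → F) x) =
        ∫ x, L (g x • ((𝓕 u : Lp F 2 (volume : Measure V)) : V → F) x) :=
      (ContinuousLinearMap.integral_comp_comm L (integrable_schwartz_smul_of_memLp g (Lp.memLp _))).symm
    rw [h1, h2, h3, h4, h5]
    refine integral_congr_ae (Eventually.of_forall fun x => ?_)
    simp only [L.map_smul]
  have hL2 : MemLp (fun ξ => L (((𝓕 u : Lp F 2 (volume : Measure V)) : V → F) ξ)) 2 volume :=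
    ContinuousLinearMap.comp_memLp' L (Lp.memLp _)
  refine ae_eq_of_integral_contDiff_smul_eq ((Lp.memLp _).locallyIntegrable (by norm_num))
    (hL2.locallyIntegrable (by norm_num)) fun φ hφ hsupp => ?_
  have hφc : HasCompactSupport fun x => ((φ x : ℝ) : ℂ) := hsupp.comp_left Complex.ofReal_zero
  have hφs : ContDiff ℝ ∞ fun x => ((φ x : ℝ) : ℂ) := Complex.ofRealCLM.contDiff.comp hφ
  have h := key (hφc.toSchwartzMap hφs)
  have hcoe : ∀ x, (hφc.toSchwartzMap hφs) x = ((φ x : ℝ) : ℂ) := fun x => rfl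
  simp only [hcoe] at h
  simpa only [Complex.real_smul, Complex.coe_smul] using h

/-! ### `T_{∂_m f} = ∂_m T_f` for `C¹` functions with `f, ∂_m f ∈ L²` -/

/-- **Integration by parts in `𝓢'`**: for `f ∈ C¹(V; F)` with `f ∈ L²` and `∂_m f ∈ L²`, the
tempered distribution of `∂_m f` is the distributional derivative `∂_m` of the distribution of
`f` (Mathlib's integration by parts for Fréchet derivatives against Schwartz functions). [folklore] -/
theorem toTemperedDistribution_fderiv_eq {f : V → F} (hf : ContDiff ℝ 1 f) (m : V)
    (hf2 : MemLp f 2 volume) (hd2 : MemLp (fun x => fderiv ℝ f x m) 2 volume) :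
    Lp.toTemperedDistribution (hd2.toLp _) =
      ∂_{m} (Lp.toTemperedDistribution (hf2.toLp f) : 𝓢'(V, F)) := by
  ext g
  rw [Lp.toTemperedDistribution_apply, TemperedDistribution.lineDerivOp_apply_apply,
    Lp.toTemperedDistribution_apply]
  have h1 : ∫ x, g x • (hd2.toLp _ : Lp F 2 (volume : Measure V)) x =
      ∫ x, g x • fderiv ℝ f x m := by
    refine integral_congr_ae ?_
    filter_upwards [hd2.coeFn_toLp] with x hx
    rw [hx]
  have h2 : ∫ x, (-∂_{m} g : 𝓢(V, ℂ)) x • (hf2.toLp f : Lp F 2 (volume : Measure V)) x =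
      -∫ x, fderiv ℝ (⇑g) x m • f x := by
    rw [← integral_neg]
    refine integral_congr_ae ?_
    filter_upwards [hf2.coeFn_toLp] with x hx
    rw [hx, neg_apply, SchwartzMap.lineDerivOp_apply_eq_fderiv, neg_smul]
  rw [h1, h2]
  -- integration by parts
  have hdg : MemLp (fun x => fderiv ℝ (⇑g) x m) 2 volume := by
    have hfun : (fun x => fderiv ℝ (⇑g) x m) = ⇑(∂_{m} g : 𝓢(V, ℂ)) :=
      funext fun x => (SchwartzMap.lineDerivOp_apply_eq_fderiv m g x).symm
    rw [hfun]
    exact (∂_{m} g : 𝓢(V, ℂ)).memLp 2 (volume : Measure V)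
  refine integral_smul_fderiv_eq_neg_fderiv_smul_of_integrable ?_ ?_ ?_ (fun x _ => g.differentiableAt)
    (fun x _ => (hf.differentiable one_ne_zero).differentiableAt)
  · have := MemLp.smul (p := 2) (q := 2) (r := 1) hf2 hdg
    exact memLp_one_iff_integrable.1 this
  · exact integrable_schwartz_smul_of_memLp g hd2
  · exact integrable_schwartz_smul_of_memLp g hf2

/-! ### Bounded multipliers and injectivity -/

omit [FiniteDimensional ℝ V] [MeasurableSpace V] [BorelSpace V] in
/-- The weight `(1+|ξ|²)^{-1}`, as a complex-valued function, has temperate growth. [folklore] -/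
theorem hasTemperateGrowth_sobolevWeight_neg_one :
    (fun ξ : V => (((1 + ‖ξ‖ ^ 2) ^ (-1 : ℝ) : ℝ) : ℂ)).HasTemperateGrowth := by
  fun_prop

omit [InnerProductSpace ℝ V] [FiniteDimensional ℝ V] [MeasurableSpace V] [BorelSpace V] in
/-- `(1+|ξ|²)^{-1} = (1+|ξ|²)⁻¹`. [folklore] -/
theorem sobolevWeight_neg_one_eq (ξ : V) : (1 + ‖ξ‖ ^ 2) ^ (-1 : ℝ) = (1 + ‖ξ‖ ^ 2)⁻¹ :=
  Real.rpow_neg_one _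

/-- The weight `(1+|ξ|²)^{-1}` is bounded by `1`, hence in `L^∞`. [folklore] -/
theorem memLp_top_sobolevWeight_neg_one :
    MemLp (fun ξ : V => (((1 + ‖ξ‖ ^ 2) ^ (-1 : ℝ) : ℝ) : ℂ)) ⊤ (volume : Measure V) := by
  refine memLp_top_of_bound
    hasTemperateGrowth_sobolevWeight_neg_one.1.continuous.aestronglyMeasurable
    1 (Eventually.of_forall fun ξ => ?_)
  rw [Complex.norm_real, sobolevWeight_neg_one_eq, Real.norm_of_nonneg (by positivity)]
  exact inv_le_one_of_one_le₀ (le_add_of_nonneg_right (sq_nonneg _))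

omit [FiniteDimensional ℝ V] [MeasurableSpace V] [BorelSpace V] in
/-- The weighted coordinate `⟨ξ, m⟩ (1+|ξ|²)^{-1}`, as a complex-valued function, has
temperate growth. [folklore] -/
theorem hasTemperateGrowth_inner_mul_sobolevWeight (m : V) :
    (fun ξ : V => ((⟪ξ, m⟫ : ℝ) : ℂ) * (((1 + ‖ξ‖ ^ 2) ^ (-1 : ℝ) : ℝ) : ℂ)).HasTemperateGrowth := by
  have h1 : (fun ξ : V => ((⟪ξ, m⟫ : ℝ) : ℂ)).HasTemperateGrowth := by fun_prop
  exact h1.mul hasTemperateGrowth_sobolevWeight_neg_one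

/-- The weighted coordinate `⟨ξ, m⟩ (1+|ξ|²)^{-1}` is bounded by `‖m‖`, hence in `L^∞`. [folklore] -/
theorem memLp_top_inner_mul_sobolevWeight (m : V) :
    MemLp (fun ξ : V => ((⟪ξ, m⟫ : ℝ) : ℂ) * (((1 + ‖ξ‖ ^ 2) ^ (-1 : ℝ) : ℝ) : ℂ)) ⊤
      (volume : Measure V) := by
  refine memLp_top_of_bound
    (hasTemperateGrowth_inner_mul_sobolevWeight m).1.continuous.aestronglyMeasurable
    ‖m‖ (Eventually.of_forall fun ξ => ?_)
  have hpos : 0 < (1 + ‖ξ‖ ^ 2)⁻¹ := inv_pos.2 (by positivity)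
  rw [norm_mul, Complex.norm_real, Complex.norm_real, sobolevWeight_neg_one_eq, Real.norm_eq_abs,
    Real.norm_eq_abs, abs_of_pos hpos]
  have h1 : |⟪ξ, m⟫| ≤ ‖ξ‖ * ‖m‖ := abs_real_inner_le_norm ξ m
  have h2 : ‖ξ‖ * (1 + ‖ξ‖ ^ 2)⁻¹ ≤ 1 := by
    rw [mul_inv_le_iff₀ (by positivity), one_mul]
    nlinarith [sq_nonneg (‖ξ‖ - 1), norm_nonneg ξ]
  calc |⟪ξ, m⟫| * (1 + ‖ξ‖ ^ 2)⁻¹ ≤ ‖ξ‖ * ‖m‖ * (1 + ‖ξ‖ ^ 2)⁻¹ := by gcongr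
    _ = ‖m‖ * (‖ξ‖ * (1 + ‖ξ‖ ^ 2)⁻¹) := by ring
    _ ≤ ‖m‖ * 1 := by gcongr
    _ = ‖m‖ := mul_one _

/-- Injectivity of `L² → 𝓢'`: two `L²` classes inducing the same tempered distribution are
equal (Mathlib `ker_toTemperedDistributionCLM_eq_bot`). [folklore] -/
theorem eq_of_toTemperedDistribution_eq {u v : Lp F 2 (volume : Measure V)}
    (h : (Lp.toTemperedDistribution u : 𝓢'(V, F)) = Lp.toTemperedDistribution v) : u = v := by
  have hker := Lp.ker_toTemperedDistributionCLM_eq_bot (F := F) (μ := (volume : Measure V)) (p := 2)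
  have hinj : Function.Injective (Lp.toTemperedDistributionCLM F (volume : Measure V) 2) :=
    LinearMap.ker_eq_bot.1 hker
  exact hinj h

/-! ### `𝓕[∂_m f] = 2πi⟨ξ,m⟩ 𝓕[f]` -/

/-- **The `L²` Fourier transform of a derivative**: for `f ∈ C¹(V; F)` with `f, ∂_m f ∈ L²`,
`𝓕[∂_m f](ξ) = 2πi ⟨ξ, m⟩ 𝓕[f](ξ)` for a.e. `ξ` (Plancherel transforms of the `L²` classes;
Stein–Weiss Ch. I Thm. 1.8 in the `L²`/`𝓢'` setting). [folklore] -/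
theorem fourier_toLp_fderiv_ae_eq {f : V → F} (hf : ContDiff ℝ 1 f) (m : V)
    (hf2 : MemLp f 2 volume) (hd2 : MemLp (fun x => fderiv ℝ f x m) 2 volume) :
    ((𝓕 (hd2.toLp _) : Lp F 2 (volume : Measure V)) : V → F) =ᵐ[volume]
      fun ξ => ((2 * Real.pi * Complex.I) * ((⟪ξ, m⟫ : ℝ) : ℂ)) •
        ((𝓕 (hf2.toLp f) : Lp F 2 (volume : Measure V)) : V → F) ξ := by
  set A : Lp F 2 (volume : Measure V) := 𝓕 (hd2.toLp _) with hA
  set B : Lp F 2 (volume : Measure V) := 𝓕 (hf2.toLp f) with hB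
  set ρ : V → ℂ := fun ξ => (((1 + ‖ξ‖ ^ 2) ^ (-1 : ℝ) : ℝ) : ℂ) with hρ
  set χ : V → ℂ := fun ξ => ((⟪ξ, m⟫ : ℝ) : ℂ) * (((1 + ‖ξ‖ ^ 2) ^ (-1 : ℝ) : ℝ) : ℂ) with hχ
  have hρt : ρ.HasTemperateGrowth := hasTemperateGrowth_sobolevWeight_neg_one
  have hχt : χ.HasTemperateGrowth := hasTemperateGrowth_inner_mul_sobolevWeight m
  have hρi : MemLp ρ ⊤ (volume : Measure V) := memLp_top_sobolevWeight_neg_one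
  have hχi : MemLp χ ⊤ (volume : Measure V) := memLp_top_inner_mul_sobolevWeight m
  have hinner : (fun ξ : V => ((⟪ξ, m⟫ : ℝ) : ℂ)).HasTemperateGrowth := by fun_prop
  -- the distributional identity `T_A = 2πi • ⟨·,m⟩ T_B`
  have hdist : (Lp.toTemperedDistribution A : 𝓢'(V, F)) =
      (2 * Real.pi * Complex.I) • smulLeftCLM F (fun ξ : V => ((⟪ξ, m⟫ : ℝ) : ℂ))
        (Lp.toTemperedDistribution B) := by
    rw [hA, ← Lp.fourier_toTemperedDistribution_eq, toTemperedDistribution_fderiv_eq hf m hf2 hd2,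
      TemperedDistribution.fourier_lineDerivOp_eq, Lp.fourier_toTemperedDistribution_eq]
  -- multiply by the bounded weight `ρ`
  have hwt : (Lp.toTemperedDistribution ((hρi.toLp ρ) • A : Lp F 2 (volume : Measure V)) :
      𝓢'(V, F)) = Lp.toTemperedDistribution
        ((2 * Real.pi * Complex.I) • ((hχi.toLp χ) • B : Lp F 2 (volume : Measure V))) := by
    rw [Lp.toTemperedDistribution_smul_eq hρt hρi A, hdist, map_smul,
      ← Lp.toTemperedDistributionCLM_apply (F := F) (μ := (volume : Measure V)) (p := 2)
        ((2 * Real.pi * Complex.I) • ((hχi.toLp χ) • B : Lp F 2 (volume : Measure V))),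
      map_smul, Lp.toTemperedDistributionCLM_apply, Lp.toTemperedDistribution_smul_eq hχt hχi B,
      TemperedDistribution.smulLeftCLM_smulLeftCLM_apply hinner hρt]
    rfl
  have heq := eq_of_toTemperedDistribution_eq hwt
  -- read off a.e.
  filter_upwards [Lp.coeFn_lpSMul (r := 2) (hρi.toLp ρ) A, Lp.coeFn_lpSMul (r := 2) (hχi.toLp χ) B,
    hρi.coeFn_toLp, hχi.coeFn_toLp,
    Lp.coeFn_smul (2 * Real.pi * Complex.I) ((hχi.toLp χ) • B : Lp F 2 (volume : Measure V)),
    (Lp.ext_iff.1 heq)] with ξ h1 h2 h3 h4 h5 h6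
  have hρξ : ρ ξ ≠ 0 := by
    show (((1 + ‖ξ‖ ^ 2) ^ (-1 : ℝ) : ℝ) : ℂ) ≠ 0
    rw [ne_eq, Complex.ofReal_eq_zero]
    exact (Real.rpow_pos_of_pos (by positivity) _).ne'
  have e1 : ρ ξ • (A : V → F) ξ = (2 * Real.pi * Complex.I) • (χ ξ • (B : V → F) ξ) := by
    have := h6
    rw [h1, Pi.smul_apply', h3, h5, Pi.smul_apply, h2, Pi.smul_apply', h4] at this
    exact this
  have e2 : χ ξ = ((⟪ξ, m⟫ : ℝ) : ℂ) * ρ ξ := rfl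
  rw [e2, smul_smul, show (2 * Real.pi * Complex.I) * (((⟪ξ, m⟫ : ℝ) : ℂ) * ρ ξ) =
    ρ ξ * ((2 * Real.pi * Complex.I) * ((⟪ξ, m⟫ : ℝ) : ℂ)) by ring, ← smul_smul] at e1
  exact smul_right_injective F hρξ e1

end Summit.NavierStokesRegularity.NavierStokesRegularity.Theorems.PerpetualPumpEulerTypeIGlue

end
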